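import Literature.NumberTheory.EllipticCurves.NeronComponentIndexTypeIIIProofs
import Literature.NumberTheory.EllipticCurves.NeronComponentIndexTypeIIIstarProofs
import HarnessLib

/-!
# Kodaira types `III` / `III*` over a discrete valuation ring: a PURE TRANSLATE `x ↦ x + r` of the
# minimal equation in `III`-shape (`b₂ ∈ 𝔪, b₄ ∈ 𝔪 ∖ 𝔪², b₆ ∈ 𝔪²`) resp. `III*`-shape
# (`b₂ ∈ 𝔪², b₄ ∈ 𝔪³ ∖ 𝔪⁴, b₆ ∈ 𝔪⁵`), and stability of the shapes under `r ↦ r + d`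
# (cell `b2b-bsdres`, team n1011, seat p04 gen 3, OWNERS row T-b9-K 'Kodaira bridge', local half)

HONEST FRAMING (cell `b2b-bsdres`, run/shared/lean/b2b/bsd-rank1-residual/, verbatim in every
file): the goal of the cell is to DELETE the COMBINATION-SHAPED residual classes of the
Birch–Swinnerton-Dyer formula for ALL analytic-rank `≤ 1` elliptic curves over `ℚ` — "full BSD
formula for every rank `≤ 1` curve in class `C`" assembled STRICTLY from published theorems — so
that the rank-`≤ 1` remainder becomes exactly the CONSTRUCTION-SHAPED classes, which are TYPED
(missing-input `Prop`s), NOT attempted. This is not "finishing BSD". Team n1011 (N10 / N11, the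
additive block X4 ∧ `p = 3`): research route on the CONSTRUCTION-SHAPED class X4; no claim beyond the
stated classes; nothing is booked. Theorems only (no definition, no named fact).

## What this file proves (local half of stub K of `cells/n1011/skel/T-b9-tame-tower.md`; the global
## half — integer translates of `integralModelInt W` for `W / ℚ` — is `TameThreeKodairaShape.lean`)

§1 (any commutative ring `R`, any ideal `I`).  The `b`-invariants of the translate `(1; r, 0, 0) • V`
(`x ↦ x + r`) are `b₂ + 12r`, `b₄ + r b₂ + 6r²`, `b₆ + 2r b₄ + r² b₂ + 4r³` (Silverman *AEC* III.1
Table 3.1 with `u = 1`; Mathlib `variableChange_b₂/₄/₆`), those of a general `D • V` are unit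
multiples `u⁻ⁱ · bᵢ((1; r, 0, 0) • V)` (`variableChange_bᵢ_eq_mul_translate`), and the
**`III`-shape** `b₂ ∈ I, b₄ ∈ I ∖ I², b₆ ∈ I²` (resp. the **`III*`-shape** `b₂ ∈ I², b₄ ∈ I³ ∖ I⁴,
b₆ ∈ I⁵`) of a translate by `r` persists for every `r'` with `r' - r ∈ I` (resp. `∈ I²`):
`IIIShape_translate_of_sub_mem`, `IIIstarShape_translate_of_sub_mem` — from the identities
`b₂' = b₂ + 12d`, `b₄' = b₄ + (d b₂ + 6d²)`, `b₆' = b₆ + (2d b₄ + d² b₂ + 4d³)`, `d = r' - r`.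

§2 (discrete valuation ring `R` with perfect residue field and `2 ∈ Rˣ`).  If Tate's algorithm
(`WeierstrassCurve.kodairaSymbolOfMinimal`, tree `DiophantineGeometry/TateAlgorithm`) returns `III`
(resp. `III*`) on `V`, then some `r ∈ R` puts `(1; r, 0, 0) • V` in `III`-shape (resp. `III*`-shape)
for `I = 𝔪`: `exists_translate_IIIShape_of_kodairaSymbolOfMinimal_eq_III`,
`exists_translate_IIIstarShape_of_kodairaSymbolOfMinimal_eq_IIIstar`.  Input: the tree's normal
forms `LocalIndex.exists_smul_of_kodairaSymbolOfMinimal_eq_III` (`a₁, a₂, a₃, a₄ ∈ 𝔪`, `a₄ ∉ 𝔪²`,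
`a₆ ∈ 𝔪²`; Silverman *ATAEC* IV.9.4 Steps 2–4) and `…_eq_IIIstar` (`π ∣ a₁, π² ∣ a₂, π³ ∣ a₃,
π³ ∥ a₄, π⁵ ∣ a₆`; Steps 2, 6, 8, 9), read on `b₂ = a₁² + 4a₂`, `b₄ = 2a₄ + a₁a₃`,
`b₆ = a₃² + 4a₆` with `2` a unit (`IIIShape_b_of_normalForm`, `IIIstarShape_b_of_normalForm`), the
unit factors `u⁻ⁱ` of the normalising change of variables being irrelevant for ideal membership.
No elliptic-curve arithmetic beyond the coefficient formulas is used.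

References: J. Tate, *Algorithm for determining the type of a singular fiber in an elliptic pencil*,
LNM 476 (1975) §§7–8; J. H. Silverman, *ATAEC* IV.9.4 Steps 2–4 and 6–9 (types `III`, `III*`);
J. H. Silverman, *AEC* III.1 Table 3.1 (`bᵢ` under `x ↦ u²x + r`).
-/

noncomputable section

open scoped Classical

open WeierstrassCurve IsLocalRing

namespace Summit.BirchSwinnertonDyer.Rank1Residual.GaloisImage

/-! ### §1. Translates `x ↦ x + r`: the `b`-invariants, and stability of the two shapes -/

section Translate

variable {R : Type*} [CommRing R] (V : WeierstrassCurve R)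

/-- `b₂` of the translate `x ↦ x + r`: `b₂ + 12r` (Silverman *AEC* III.1 Table 3.1, `u = 1`).
[folklore] -/
theorem translate_b₂ (r : R) :
    ((⟨1, r, 0, 0⟩ : VariableChange R) • V).b₂ = V.b₂ + 12 * r := by
  rw [variableChange_b₂]; simp

/-- `b₄` of the translate `x ↦ x + r`: `b₄ + r b₂ + 6r²` (Silverman *AEC* III.1 Table 3.1).
[folklore] -/
theorem translate_b₄ (r : R) :
    ((⟨1, r, 0, 0⟩ : VariableChange R) • V).b₄ = V.b₄ + r * V.b₂ + 6 * r ^ 2 := by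
  rw [variableChange_b₄]; simp

/-- `b₆` of the translate `x ↦ x + r`: `b₆ + 2r b₄ + r² b₂ + 4r³` (Silverman *AEC* III.1 Table 3.1).
[folklore] -/
theorem translate_b₆ (r : R) :
    ((⟨1, r, 0, 0⟩ : VariableChange R) • V).b₆ =
      V.b₆ + 2 * r * V.b₄ + r ^ 2 * V.b₂ + 4 * r ^ 3 := by
  rw [variableChange_b₆]; simp

/-- For any change of variables `D = (u; r, s, t)`, `b₂(D • V) = u⁻² · b₂((1; r, 0, 0) • V)`:
the `b`-invariants see only `u` and `r`. [folklore] -/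
theorem variableChange_b₂_eq_mul_translate (D : VariableChange R) :
    (D • V).b₂ = (↑D.u⁻¹ : R) ^ 2 * ((⟨1, D.r, 0, 0⟩ : VariableChange R) • V).b₂ := by
  rw [variableChange_b₂, translate_b₂]

/-- `b₄(D • V) = u⁻⁴ · b₄((1; r, 0, 0) • V)`. [folklore] -/
theorem variableChange_b₄_eq_mul_translate (D : VariableChange R) :
    (D • V).b₄ = (↑D.u⁻¹ : R) ^ 4 * ((⟨1, D.r, 0, 0⟩ : VariableChange R) • V).b₄ := by
  rw [variableChange_b₄, translate_b₄]

/-- `b₆(D • V) = u⁻⁶ · b₆((1; r, 0, 0) • V)`. [folklore] -/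
theorem variableChange_b₆_eq_mul_translate (D : VariableChange R) :
    (D • V).b₆ = (↑D.u⁻¹ : R) ^ 6 * ((⟨1, D.r, 0, 0⟩ : VariableChange R) • V).b₆ := by
  rw [variableChange_b₆, translate_b₆]

/-- Translating further by `d`: `b₂` changes by `12d`. [folklore] -/
theorem translate_add_b₂ (r d : R) :
    ((⟨1, r + d, 0, 0⟩ : VariableChange R) • V).b₂ =
      ((⟨1, r, 0, 0⟩ : VariableChange R) • V).b₂ + 12 * d := by
  rw [translate_b₂, translate_b₂]; ring

/-- Translating further by `d`: `b₄` changes by `d b₂ + 6d²` (`b₂` of the first translate).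
[folklore] -/
theorem translate_add_b₄ (r d : R) :
    ((⟨1, r + d, 0, 0⟩ : VariableChange R) • V).b₄ =
      ((⟨1, r, 0, 0⟩ : VariableChange R) • V).b₄ +
        (d * ((⟨1, r, 0, 0⟩ : VariableChange R) • V).b₂ + 6 * d ^ 2) := by
  rw [translate_b₄, translate_b₄, translate_b₂]; ring

/-- Translating further by `d`: `b₆` changes by `2d b₄ + d² b₂ + 4d³` (`bᵢ` of the first translate).
[folklore] -/
theorem translate_add_b₆ (r d : R) :
    ((⟨1, r + d, 0, 0⟩ : VariableChange R) • V).b₆ =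
      ((⟨1, r, 0, 0⟩ : VariableChange R) • V).b₆ +
        (2 * (d * ((⟨1, r, 0, 0⟩ : VariableChange R) • V).b₄) +
          d ^ 2 * ((⟨1, r, 0, 0⟩ : VariableChange R) • V).b₂ + 4 * d ^ 3) := by
  rw [translate_b₆, translate_b₆, translate_b₄, translate_b₂]; ring

/-- `a ∈ Iᵐ`, `b ∈ Iⁿ` give `ab ∈ Iᵐ⁺ⁿ`. [folklore] -/
theorem mul_mem_pow_add_of_mem_pow {I : Ideal R} {a b : R} {m n : ℕ} (ha : a ∈ I ^ m) (hb : b ∈ I ^ n) :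
    a * b ∈ I ^ (m + n) := by
  rw [pow_add]; exact Ideal.mul_mem_mul ha hb

/-- `a ∈ Iᵐ` gives `aⁿ ∈ Iᵐⁿ`. [folklore] -/
theorem pow_mem_pow_mul_of_mem_pow {I : Ideal R} {a : R} {m : ℕ} (ha : a ∈ I ^ m) (n : ℕ) :
    a ^ n ∈ I ^ (m * n) := by
  rw [pow_mul]; exact Ideal.pow_mem_pow ha n

/-- **The `III`-shape `b₂ ∈ I, b₄ ∈ I ∖ I², b₆ ∈ I²` is stable under `r ↦ r'` with `r' - r ∈ I`**
(any commutative ring, any ideal): `b₂' = b₂ + 12d`, `b₄' = b₄ + (d b₂ + 6d²)` with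
`d b₂ + 6d² ∈ I²`, `b₆' = b₆ + (2d b₄ + d² b₂ + 4d³)` with the bracket in `I²`. [folklore] -/
theorem IIIShape_translate_of_sub_mem (I : Ideal R) {r r' : R} (h : r' - r ∈ I)
    (h₂ : ((⟨1, r, 0, 0⟩ : VariableChange R) • V).b₂ ∈ I)
    (h₄ : ((⟨1, r, 0, 0⟩ : VariableChange R) • V).b₄ ∈ I)
    (h₄' : ((⟨1, r, 0, 0⟩ : VariableChange R) • V).b₄ ∉ I ^ 2)
    (h₆ : ((⟨1, r, 0, 0⟩ : VariableChange R) • V).b₆ ∈ I ^ 2) :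
    ((⟨1, r', 0, 0⟩ : VariableChange R) • V).b₂ ∈ I ∧
      ((⟨1, r', 0, 0⟩ : VariableChange R) • V).b₄ ∈ I ∧
      ((⟨1, r', 0, 0⟩ : VariableChange R) • V).b₄ ∉ I ^ 2 ∧
      ((⟨1, r', 0, 0⟩ : VariableChange R) • V).b₆ ∈ I ^ 2 := by
  obtain ⟨d, rfl⟩ : ∃ d, r' = r + d := ⟨r' - r, by ring⟩
  have hd : d ∈ I := by simpa using h
  set X := ((⟨1, r, 0, 0⟩ : VariableChange R) • V) with hX
  have hI2 : I ^ 2 ≤ I := Ideal.pow_le_self two_ne_zero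
  have hd2 : d ^ 2 ∈ I ^ 2 := Ideal.pow_mem_pow hd 2
  have hd1 : d ∈ I ^ 1 := by rwa [pow_one]
  have h₂1 : X.b₂ ∈ I ^ 1 := by rwa [pow_one]
  have h₄1 : X.b₄ ∈ I ^ 1 := by rwa [pow_one]
  have hdb₂ : d * X.b₂ ∈ I ^ 2 := mul_mem_pow_add_of_mem_pow hd1 h₂1
  have hdb₄ : d * X.b₄ ∈ I ^ 2 := mul_mem_pow_add_of_mem_pow hd1 h₄1
  have e₄ : d * X.b₂ + 6 * d ^ 2 ∈ I ^ 2 := add_mem hdb₂ (Ideal.mul_mem_left _ _ hd2)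
  have e₆ : 2 * (d * X.b₄) + d ^ 2 * X.b₂ + 4 * d ^ 3 ∈ I ^ 2 :=
    add_mem (add_mem (Ideal.mul_mem_left _ _ hdb₄) (Ideal.mul_mem_right _ _ hd2))
      (Ideal.mul_mem_left _ _ (Ideal.pow_le_pow_right (by norm_num) (Ideal.pow_mem_pow hd 3)))
  refine ⟨?_, ?_, ?_, ?_⟩
  · rw [translate_add_b₂, ← hX]; exact add_mem h₂ (Ideal.mul_mem_left _ _ hd)
  · rw [translate_add_b₄, ← hX]; exact add_mem h₄ (hI2 e₄)
  · rw [translate_add_b₄, ← hX]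
    intro h'
    exact h₄' (by simpa using Ideal.sub_mem _ h' e₄)
  · rw [translate_add_b₆, ← hX]; exact add_mem h₆ e₆

/-- **The `III*`-shape `b₂ ∈ I², b₄ ∈ I³ ∖ I⁴, b₆ ∈ I⁵` is stable under `r ↦ r'` with
`r' - r ∈ I²`**: now `12d ∈ I²`, `d b₂ + 6d² ∈ I⁴`, `2d b₄ + d² b₂ + 4d³ ∈ I⁵`. [folklore] -/
theorem IIIstarShape_translate_of_sub_mem (I : Ideal R) {r r' : R} (h : r' - r ∈ I ^ 2)
    (h₂ : ((⟨1, r, 0, 0⟩ : VariableChange R) • V).b₂ ∈ I ^ 2)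
    (h₄ : ((⟨1, r, 0, 0⟩ : VariableChange R) • V).b₄ ∈ I ^ 3)
    (h₄' : ((⟨1, r, 0, 0⟩ : VariableChange R) • V).b₄ ∉ I ^ 4)
    (h₆ : ((⟨1, r, 0, 0⟩ : VariableChange R) • V).b₆ ∈ I ^ 5) :
    ((⟨1, r', 0, 0⟩ : VariableChange R) • V).b₂ ∈ I ^ 2 ∧
      ((⟨1, r', 0, 0⟩ : VariableChange R) • V).b₄ ∈ I ^ 3 ∧
      ((⟨1, r', 0, 0⟩ : VariableChange R) • V).b₄ ∉ I ^ 4 ∧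
      ((⟨1, r', 0, 0⟩ : VariableChange R) • V).b₆ ∈ I ^ 5 := by
  obtain ⟨d, rfl⟩ : ∃ d, r' = r + d := ⟨r' - r, by ring⟩
  have hd : d ∈ I ^ 2 := by simpa using h
  set X := ((⟨1, r, 0, 0⟩ : VariableChange R) • V) with hX
  have hd2 : d ^ 2 ∈ I ^ 4 := pow_mem_pow_mul_of_mem_pow hd 2
  have hd3 : d ^ 3 ∈ I ^ 6 := pow_mem_pow_mul_of_mem_pow hd 3
  have hdb₂ : d * X.b₂ ∈ I ^ 4 := mul_mem_pow_add_of_mem_pow hd h₂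
  have hdb₄ : d * X.b₄ ∈ I ^ 5 := mul_mem_pow_add_of_mem_pow hd h₄
  have hd2b₂ : d ^ 2 * X.b₂ ∈ I ^ 6 := mul_mem_pow_add_of_mem_pow hd2 h₂
  have e₄ : d * X.b₂ + 6 * d ^ 2 ∈ I ^ 4 := add_mem hdb₂ (Ideal.mul_mem_left _ _ hd2)
  have e₆ : 2 * (d * X.b₄) + d ^ 2 * X.b₂ + 4 * d ^ 3 ∈ I ^ 5 :=
    add_mem (add_mem (Ideal.mul_mem_left _ _ hdb₄) (Ideal.pow_le_pow_right (by norm_num) hd2b₂))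
      (Ideal.mul_mem_left _ _ (Ideal.pow_le_pow_right (by norm_num) hd3))
  refine ⟨?_, ?_, ?_, ?_⟩
  · rw [translate_add_b₂, ← hX]; exact add_mem h₂ (Ideal.mul_mem_left _ _ hd)
  · rw [translate_add_b₄, ← hX]; exact add_mem h₄ (Ideal.pow_le_pow_right (by norm_num) e₄)
  · rw [translate_add_b₄, ← hX]
    intro h'
    exact h₄' (by simpa using Ideal.sub_mem _ h' e₄)
  · rw [translate_add_b₆, ← hX]; exact add_mem h₆ e₆

end Translate

/-! ### §2. Over a discrete valuation ring with `2 ∈ Rˣ`: the shapes from Tate's normal forms -/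

section DVR

variable {R : Type*} [CommRing R] [IsDomain R] [IsDiscreteValuationRing R]

/-- **Type-`III` normal form ⟹ `III`-shape of the `b`'s** (`2 ∈ Rˣ`): from `a₁, a₂, a₃, a₄ ∈ 𝔪`,
`a₄ ∉ 𝔪²`, `a₆ ∈ 𝔪²` one gets `b₂ = a₁² + 4a₂ ∈ 𝔪`, `b₄ = 2a₄ + a₁a₃ ∈ 𝔪 ∖ 𝔪²`,
`b₆ = a₃² + 4a₆ ∈ 𝔪²` (Silverman *ATAEC* IV.9.4 Step 4). [folklore] -/
theorem IIIShape_b_of_normalForm (h2 : IsUnit (2 : R)) (N : WeierstrassCurve R)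
    (h₁ : N.a₁ ∈ maximalIdeal R) (h₂ : N.a₂ ∈ maximalIdeal R) (h₃ : N.a₃ ∈ maximalIdeal R)
    (h₄ : N.a₄ ∈ maximalIdeal R) (h₄' : N.a₄ ∉ maximalIdeal R ^ 2)
    (h₆ : N.a₆ ∈ maximalIdeal R ^ 2) :
    N.b₂ ∈ maximalIdeal R ∧ N.b₄ ∈ maximalIdeal R ∧ N.b₄ ∉ maximalIdeal R ^ 2 ∧
      N.b₆ ∈ maximalIdeal R ^ 2 := by
  have hI2 : maximalIdeal R ^ 2 ≤ maximalIdeal R := Ideal.pow_le_self two_ne_zero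
  have h₁1 : N.a₁ ∈ maximalIdeal R ^ 1 := by rwa [pow_one]
  have h₃1 : N.a₃ ∈ maximalIdeal R ^ 1 := by rwa [pow_one]
  have h13 : N.a₁ * N.a₃ ∈ maximalIdeal R ^ 2 := mul_mem_pow_add_of_mem_pow h₁1 h₃1
  refine ⟨?_, ?_, ?_, ?_⟩
  · rw [WeierstrassCurve.b₂]
    exact add_mem (hI2 (Ideal.pow_mem_pow h₁ 2)) (Ideal.mul_mem_left _ _ h₂)
  · rw [WeierstrassCurve.b₄]
    exact add_mem (Ideal.mul_mem_left _ _ h₄) (hI2 h13)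
  · rw [WeierstrassCurve.b₄]
    intro h
    have h2a : 2 * N.a₄ ∈ maximalIdeal R ^ 2 := by simpa using Ideal.sub_mem _ h h13
    exact h₄' ((Ideal.unit_mul_mem_iff_mem _ h2).mp h2a)
  · rw [WeierstrassCurve.b₆]
    exact add_mem (Ideal.pow_mem_pow h₃ 2) (Ideal.mul_mem_left _ _ h₆)

/-- **Type-`III*` normal form ⟹ `III*`-shape of the `b`'s** (`2 ∈ Rˣ`): from `π ∣ a₁`, `π² ∣ a₂`,
`π³ ∣ a₃`, `π³ ∣ a₄`, `π⁴ ∤ a₄`, `π⁵ ∣ a₆` one gets `b₂ ∈ 𝔪²`, `b₄ ∈ 𝔪³ ∖ 𝔪⁴`, `b₆ ∈ 𝔪⁵`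
(Silverman *ATAEC* IV.9.4 Step 9). [folklore] -/
theorem IIIstarShape_b_of_normalForm (h2 : IsUnit (2 : R)) (N : WeierstrassCurve R)
    (h₁ : N.a₁ ∈ maximalIdeal R) (h₂ : N.a₂ ∈ maximalIdeal R ^ 2)
    (h₃ : N.a₃ ∈ maximalIdeal R ^ 3) (h₄ : N.a₄ ∈ maximalIdeal R ^ 3)
    (h₄' : N.a₄ ∉ maximalIdeal R ^ 4) (h₆ : N.a₆ ∈ maximalIdeal R ^ 5) :
    N.b₂ ∈ maximalIdeal R ^ 2 ∧ N.b₄ ∈ maximalIdeal R ^ 3 ∧ N.b₄ ∉ maximalIdeal R ^ 4 ∧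
      N.b₆ ∈ maximalIdeal R ^ 5 := by
  have h₁1 : N.a₁ ∈ maximalIdeal R ^ 1 := by rwa [pow_one]
  have h13 : N.a₁ * N.a₃ ∈ maximalIdeal R ^ 4 := mul_mem_pow_add_of_mem_pow h₁1 h₃
  have h33 : N.a₃ ^ 2 ∈ maximalIdeal R ^ 6 := pow_mem_pow_mul_of_mem_pow h₃ 2
  refine ⟨?_, ?_, ?_, ?_⟩
  · rw [WeierstrassCurve.b₂]
    exact add_mem (pow_mem_pow_mul_of_mem_pow h₁1 2) (Ideal.mul_mem_left _ _ h₂)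
  · rw [WeierstrassCurve.b₄]
    exact add_mem (Ideal.mul_mem_left _ _ h₄) (Ideal.pow_le_pow_right (by norm_num) h13)
  · rw [WeierstrassCurve.b₄]
    intro h
    have h2a : 2 * N.a₄ ∈ maximalIdeal R ^ 4 := by simpa using Ideal.sub_mem _ h h13
    exact h₄' ((Ideal.unit_mul_mem_iff_mem _ h2).mp h2a)
  · rw [WeierstrassCurve.b₆]
    exact add_mem (Ideal.pow_le_pow_right (by norm_num) h33) (Ideal.mul_mem_left _ _ h₆)

/-- **Type `III` ⟹ a pure translate in `III`-shape** (DVR with perfect residue field, `2 ∈ Rˣ`): if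
Tate's algorithm returns `III` on `V`, some `r ∈ R` has `b₂((1;r,0,0) • V) ∈ 𝔪`,
`b₄ ∈ 𝔪 ∖ 𝔪²`, `b₆ ∈ 𝔪²` — the normal form `D • V` of
`LocalIndex.exists_smul_of_kodairaSymbolOfMinimal_eq_III` with the unit factors `u⁻ⁱ` dropped.
[cite: SilvermanATAEC1994, IV.9.4 Step 4] -/
theorem exists_translate_IIIShape_of_kodairaSymbolOfMinimal_eq_III
    [PerfectField (ResidueField R)] (h2 : IsUnit (2 : R)) (V : WeierstrassCurve R)
    (hV : V.kodairaSymbolOfMinimal = .III) :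
    ∃ r : R, ((⟨1, r, 0, 0⟩ : VariableChange R) • V).b₂ ∈ maximalIdeal R ∧
      ((⟨1, r, 0, 0⟩ : VariableChange R) • V).b₄ ∈ maximalIdeal R ∧
      ((⟨1, r, 0, 0⟩ : VariableChange R) • V).b₄ ∉ maximalIdeal R ^ 2 ∧
      ((⟨1, r, 0, 0⟩ : VariableChange R) • V).b₆ ∈ maximalIdeal R ^ 2 := by
  obtain ⟨D, h₁, h₂', h₃, h₄, h₄', h₆⟩ :=
    Literature.NumberTheory.EllipticCurves.LocalIndex.exists_smul_of_kodairaSymbolOfMinimal_eq_III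
      V hV
  obtain ⟨hb₂, hb₄, hb₄', hb₆⟩ := IIIShape_b_of_normalForm h2 (D • V) h₁ h₂' h₃ h₄ h₄' h₆
  have hu : ∀ k : ℕ, IsUnit ((↑D.u⁻¹ : R) ^ k) := fun k ↦ (Units.isUnit _).pow k
  refine ⟨D.r, ?_, ?_, ?_, ?_⟩
  · rw [variableChange_b₂_eq_mul_translate] at hb₂
    exact (Ideal.unit_mul_mem_iff_mem _ (hu 2)).mp hb₂
  · rw [variableChange_b₄_eq_mul_translate] at hb₄
    exact (Ideal.unit_mul_mem_iff_mem _ (hu 4)).mp hb₄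
  · rw [variableChange_b₄_eq_mul_translate] at hb₄'
    exact fun h ↦ hb₄' ((Ideal.unit_mul_mem_iff_mem _ (hu 4)).mpr h)
  · rw [variableChange_b₆_eq_mul_translate] at hb₆
    exact (Ideal.unit_mul_mem_iff_mem _ (hu 6)).mp hb₆

/-- **Type `III*` ⟹ a pure translate in `III*`-shape** (DVR with perfect residue field, `2 ∈ Rˣ`):
`b₂((1;r,0,0) • V) ∈ 𝔪²`, `b₄ ∈ 𝔪³ ∖ 𝔪⁴`, `b₆ ∈ 𝔪⁵` for some `r ∈ R`
(`LocalIndex.exists_smul_of_kodairaSymbolOfMinimal_eq_IIIstar`, unit factors dropped).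
[cite: SilvermanATAEC1994, IV.9.4 Steps 6–9] -/
theorem exists_translate_IIIstarShape_of_kodairaSymbolOfMinimal_eq_IIIstar
    [PerfectField (ResidueField R)] (h2 : IsUnit (2 : R)) (V : WeierstrassCurve R)
    (hV : V.kodairaSymbolOfMinimal = .IIIstar) :
    ∃ r : R, ((⟨1, r, 0, 0⟩ : VariableChange R) • V).b₂ ∈ maximalIdeal R ^ 2 ∧
      ((⟨1, r, 0, 0⟩ : VariableChange R) • V).b₄ ∈ maximalIdeal R ^ 3 ∧
      ((⟨1, r, 0, 0⟩ : VariableChange R) • V).b₄ ∉ maximalIdeal R ^ 4 ∧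
      ((⟨1, r, 0, 0⟩ : VariableChange R) • V).b₆ ∈ maximalIdeal R ^ 5 := by
  obtain ⟨D, h₁, h₂', h₃, h₄, h₄', h₆⟩ :=
    Literature.NumberTheory.EllipticCurves.LocalIndex.exists_smul_of_kodairaSymbolOfMinimal_eq_IIIstar
      V hV
  obtain ⟨hb₂, hb₄, hb₄', hb₆⟩ := IIIstarShape_b_of_normalForm h2 (D • V) h₁ h₂' h₃ h₄ h₄' h₆
  have hu : ∀ k : ℕ, IsUnit ((↑D.u⁻¹ : R) ^ k) := fun k ↦ (Units.isUnit _).pow k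
  refine ⟨D.r, ?_, ?_, ?_, ?_⟩
  · rw [variableChange_b₂_eq_mul_translate] at hb₂
    exact (Ideal.unit_mul_mem_iff_mem _ (hu 2)).mp hb₂
  · rw [variableChange_b₄_eq_mul_translate] at hb₄
    exact (Ideal.unit_mul_mem_iff_mem _ (hu 4)).mp hb₄
  · rw [variableChange_b₄_eq_mul_translate] at hb₄'
    exact fun h ↦ hb₄' ((Ideal.unit_mul_mem_iff_mem _ (hu 4)).mpr h)
  · rw [variableChange_b₆_eq_mul_translate] at hb₆
    exact (Ideal.unit_mul_mem_iff_mem _ (hu 6)).mp hb₆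

end DVR

end Summit.BirchSwinnertonDyer.Rank1Residual.GaloisImage

end
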